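import Summits.BirchSwinnertonDyer.BirchSwinnertonDyer.Theorems.SemiOrdinaryEisensteinDescentWildKolyvaginUpperAtThreeOfPrimitives
import Summits.BirchSwinnertonDyer.BirchSwinnertonDyer.Theorems.WildThreeRankOneBSDpOfGlobalDivisibility
import Summits.BirchSwinnertonDyer.BirchSwinnertonDyer.Theorems.KolyvaginRankOneOfGross1991E0Prop37
import Summits.BirchSwinnertonDyer.Rank1Residual.X11b.KolyvaginShaAtPrimeOfGross1991
import HarnessLib

/-!
# Route `SemiOrdinaryEisensteinDescent`, crux Ko `WildKolyvaginUpperAtThree` (stmt-BirchSwinnertonDyer-20480), line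
# `birth` v3: Ko BY NAME from J + the THREE primitives {Cassels–Tate level inputs, Gross 3.7 (2), GZ86 III (3.1)}
# — NO `kolyvagin` fact (width seat `bsd-wall-soed-p2-w2` g2; `--supports stmt-BirchSwinnertonDyer-20480`)

WHY. Line `birth` v3's print stub is `stub_inputsPrim = (∀ N W K, kolyvagin N W K) ∧ (∀ K, casselsTate_levelInputs K) ∧
prop37_2_frobeniusCongruence ∧ Gross1991_heegnerPoint_sub_ratTorsion_mem_E0`, and its composition (p581112) uses
Kolyvagin's Thm. A only for `rank E(K) = 1` and `#Ш(E/K) < ∞` inside kmc g17's receptacle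
`SchneiderFree.Exact.upper_of_globalDivisibility`. On the crux's cell both uses are now KERNEL theorems modulo the
OTHER two primitives: (a) `rank E(K) = 1` = `KolyvaginRankOneOfGross1991E0Prop37.mordellWeilRank_eq_one_…` (this seat:
x11b3's point-level END at `M = 1` → `Gross1991_kolyvaginClasses`; Gross Prop. 8.2 from the PROVED Poitou–Tate reciprocity
→ Prop. 2.1 → rank one with Serre PROVED); (b) finiteness of ALL of `Ш(E/K)` is NOT needed — the socket reads
`ord₃ (Nat.card Ш(E/K))`, which is `ord₃ #Ш(E/K)[3^∞]` when `Ш` is finite and `ord₃ 0 = 0` otherwise, so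
`ord₃ #Ш ≤ ord₃ #Ш[3^∞]` unconditionally (`padicValNat_shaOrder_le_card_primaryComponent`). Hence Ko's composition
needs NO `kolyvagin` at all: **Ko ⟸ J + {CT level inputs, 3.7 (2), GZ86 III (3.1)}**, and `stub_inputsPrim`'s first
conjunct is idle for the line (the already-landed `…OfPrimitives.wildKolyvaginUpperAtThree_of_sigma_of_primInputs`, same
statement, closes the v3 skeleton; the lead may drop conjunct (i) at the next reshape; nothing on the ledger is changed here).

WHAT IS PROVED (CONDITIONAL on the displayed hypotheses; nothing about any curve is asserted):
* `padicValNat_shaOrder_le_card_primaryComponent` — `ord_p #Ш ≤ ord_p #Ш[p^∞]` for the tree's `shaOrder = Nat.card Ш`.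
* `upper_of_globalDivisibility_of_threePrimitives` — kmc g17's receptacle with `hKo` REMOVED: global divisibility to depth
  `ord_p ∏c_ℓ + s` + McCallum Cor. 5.6 upper form (named `hMcU`) + {3.7 (2), E0} ⟹ the socket
  `Upper.IndexUpperBoundLeAt W p K P s`, for `W` minimal, odd `p` with the `p`-adic tower onto, `K` imaginary quadratic
  Heegner with `d_K ∉ {−3,−4}`, `P = y_K` non-torsion on a frame `(Dt, H, ι)`.
* `wildKolyvaginUpperAtThree_of_globalDivisibility_of_threePrimitives`, `wildKolyvaginUpperAtThree_of_sigma_of_threePrimitives`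
  — **Ko BY NAME ⟸ J (displayed / BY NAME) + `(∀ K, casselsTate_levelInputs K)` + `prop37_2_frobeniusCongruence` +
  `Gross1991_heegnerPoint_sub_ratTorsion_mem_E0`** (McCallum Cor. 5.6 from the three by bsd-stepL's kernel derivation).
Ko, J, the refined Kolyvagin conjecture at `3` and BSD stay open.

References: [GrossLMS1991] §1 Thm. 1.3, §2 Prop. 2.1, §3 Prop. 3.7 (2), §6, §8 Prop. 8.2; [McCallumLMS1991] §1, §5 Lemma 5.1,
Cor. 5.6; [GrossZagier1986] III (3.1); [MilneADT2006] I §6; [Jetchev2008] Conj. 1.3, (1) p. 812; [Serre1972] §4.2 Thm. 2.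
-/

set_option autoImplicit false
set_option linter.dupNamespace false -- `Summit.BirchSwinnertonDyer.BirchSwinnertonDyer.…` is the tree's layout (D-0017)

noncomputable section

open scoped Classical

namespace Summit.BirchSwinnertonDyer.BirchSwinnertonDyer.Theorems.WildKolyvaginUpperAtThreeOfThreePrimitives

open WeierstrassCurve NumberField IsDedekindDomain Field
  Literature.NumberTheory.EllipticCurves
  Literature.NumberTheory.EllipticCurves.ModularForms
  Literature.NumberTheory.EllipticCurves.Rank1Residual
  Summit.BirchSwinnertonDyer.Rank1Residual
  Summit.BirchSwinnertonDyer.Rank1Residual.Additive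
  Summit.BirchSwinnertonDyer.Rank1Residual.X11b
  Summit.BirchSwinnertonDyer.Rank1Residual.X11b.Three
  Summit.BirchSwinnertonDyer.BirchSwinnertonDyer.Theses.SemiOrdinaryEisensteinDescent
  Summit.BirchSwinnertonDyer.BirchSwinnertonDyer.Theorems.SchneiderFree
  Summit.BirchSwinnertonDyer.BirchSwinnertonDyer.Theorems.KolyvaginRankOneOfGross1991E0Prop37
open Literature.NumberTheory.EllipticCurves.GrossLMS1991 (prop37_2_frobeniusCongruence
  prop37_2_reductionCongruence_of_frobeniusCongruence)

/-! ## §0 `ord_p #Ш ≤ ord_p #Ш[p^∞]` for the tree's `shaOrder = Nat.card Ш` (no finiteness needed) -/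

/-- For the tree's `shaOrder E = Nat.card Ш(E)`: `ord_p (shaOrder E) ≤ ord_p (Nat.card Ш(E)[p^∞])` — equality when `Ш(E)`
is finite (`Koly.padicValNat_shaOrder_eq`), and `Nat.card` of an infinite group is `0` otherwise. [folklore] -/
theorem padicValNat_shaOrder_le_card_primaryComponent {F : Type*} [Field F] [NumberField F] (E : WeierstrassCurve F)
    (p : ℕ) [Fact p.Prime] :
    padicValNat p E.shaOrder ≤ padicValNat p (Nat.card (AddCommGroup.primaryComponent E.sha p)) := by
  by_cases hfin : Finite E.sha
  · exact (Koly.padicValNat_shaOrder_eq E p).le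
  · haveI : Infinite E.sha := not_finite_iff_infinite.mp hfin
    have h0 : E.shaOrder = 0 := Nat.card_eq_zero_of_infinite
    rw [h0, padicValNat_zero_right]
    exact Nat.zero_le _

/-! ## §1 kmc g17's McCallum-road receptacle WITHOUT Kolyvagin's theorem -/

/-- **co-STEP L at slack `s` from global divisibility to depth `ord_p ∏ c_ℓ + s` + McCallum 1991 Cor. 5.6 (upper form,
named `hMcU`) + {Gross 3.7 (2), GZ86 III (3.1)} — NO `kolyvagin`.** kmc g17's `SchneiderFree.Exact.upper_of_globalDivisibility`
VERBATIM except: `rank E(K) = 1` is `mordellWeilRank_eq_one_of_gross1991E0_of_frobeniusCongruence` (kernel, modulo the two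
facts) instead of `kolyvagin`, and `ord_p #Ш ≤ ord_p #Ш[p^∞]` (§0) replaces `Ш` finite. For `W` globally minimal, `p` odd with
`ρ̄_{E,p^n}` onto for all `n`, `K : Type` imaginary quadratic with `d_K ∉ {−3,−4}` and the Heegner hypothesis for `N_E`, a frame
`(Dt, H, ι)` with `P = y_K` non-torsion. CONDITIONAL on `hMcU`, `h372`, `hE0`, `hglob`.
[cite: McCallumLMS1991, §5 Cor. 5.6 (p. 310) and Lemma 5.1 (p. 303)] [cite: GrossLMS1991, §1 Thm. 1.3 (1), §2 Prop. 2.1]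
[cite: Jetchev2008, (1) and Cor. 1.5 (p. 812)] -/
theorem upper_of_globalDivisibility_of_threePrimitives
    (hMcU : McCallum1991_padicValNat_card_sha_primary_add_le_of_globalDivisibility)
    (h372 : prop37_2_frobeniusCongruence) (hE0 : Gross1991_heegnerPoint_sub_ratTorsion_mem_E0)
    (W : WeierstrassCurve ℚ) [W.IsElliptic] [W.IsGloballyMinimal] [NeZero (W.conductorNorm ℤ)]
    (p : ℕ) [Fact p.Prime] (hp2 : p ≠ 2) (hρ : ∀ n : ℕ, W.HasSurjectiveModNGaloisRep (p ^ n : ℕ))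
    (K : Type) [Field K] [NumberField K] (hK : IsImaginaryQuadratic K)
    (h3 : NumberField.discr K ≠ -3) (h4 : NumberField.discr K ≠ -4)
    (hHH : SatisfiesHeegnerHypothesis (W.conductorNorm ℤ) K)
    (Dt : ModularParametrizationData W (W.conductorNorm ℤ))
    (H : HeegnerDatum (W.conductorNorm ℤ) (NumberField.discr K)) (ι : K →+* ℂ)
    (P : (W.baseChange K).toAffine.Point)
    (hP : WeierstrassCurve.Affine.Point.map ι.toRatAlgHom P = heegnerPointComplex Dt H)
    (hnt : ¬ IsOfFinAddOrder P) {s : ℕ}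
    (hglob : ∀ (s' : ℕ), s' ≤ padicValNat p W.tamagawaProduct + s →
      ∀ (n : ℕ) (d : KolyvaginHeegnerData Dt H.β ι n), Squarefree n →
        (∀ ℓ ∈ n.primeFactors, Zhang2014.IsKolyvaginPrime (W.conductorNorm ℤ) W K p ℓ ∧
          s' ≤ Zhang2014.kolyvaginIndex W p ℓ) → Koly.PDiv d p s') :
    Upper.IndexUpperBoundLeAt W p K P s := by
  have hp : p.Prime := Fact.out
  -- mod-`p` image onto, hence irreducible and non-CM
  have hsurj : W.HasSurjectiveModNGaloisRep p := by simpa using hρ 1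
  have hCM : ¬ W.HasCM := fun hCM ↦ W.not_hasSurjectiveModNGaloisRep_of_hasCM hCM hp hp2 hsurj
  haveI : NeZero ((p : ℕ) : ℚ) := ⟨by exact_mod_cast hp.ne_zero⟩
  have hirr : W.HasIrreducibleModPGaloisRep p :=
    hasIrreducibleModPGaloisRep_of_hasSurjectiveModNGaloisRep W p hsurj
  -- rank one (Kolyvagin Thm. A (1)) — kernel, modulo {3.7 (2), E0}
  have hrank : (W.baseChange K).mordellWeilRank = 1 :=
    (mordellWeilRank_eq_one_of_gross1991E0_of_frobeniusCongruence (W.conductorNorm ℤ) W rfl hE0 h372 hCM hK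
      ⟨h3, h4⟩ hHH ⟨Dt, H, ι, hP⟩ hnt).1
  -- no `p`-torsion in `E(K)`
  have hbot := torsionBy_eq_bot_of_isImaginaryQuadratic_of_hasIrreducibleModPGaloisRep W K hK hp hirr
  have hiv : ∀ x : (W.baseChange K).toAffine.Point, p • x = 0 → x = 0 := fun x hx ↦ by
    have hmem : x ∈ AddSubgroup.torsionBy (W.baseChange K).toAffine.Point ((p : ℕ) : ℤ) := by
      rw [mem_torsionBy_iff, natCast_zsmul]
      exact hx
    rw [hbot] at hmem
    exact hmem
  -- the conductor-`1` Kolyvagin–Heegner datum on the frame `(Dt, H.β, ι)` (Darmon 2004, Thm. 3.6)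
  obtain ⟨d₁⟩ := exists_kolyvaginHeegnerData_one
    (phi_heegnerTau_mem_singularModuliField_holds (W.conductorNorm ℤ) W K) hK Dt H.β ι H.dvd_sq_sub
  -- its bottom point is `P` in `E(K̄)` (Shimura reciprocity at conductor `1`)
  have hPd : d₁.toGeomPoints d₁.derivedPoint = toGeomPoints (W.baseChange K) P :=
    KolyvaginBottom.toGeomPoints_derivedPoint_one_eq
      (heegnerPointOfConductor_one_galoisConj_holds (W.conductorNorm ℤ) W K) hK hHH hP d₁ rfl
  -- `p^{M₀} ∥ P` (Mordell–Weil)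
  haveI : Module.Finite ℤ (W.baseChange K).toAffine.Point := (W.baseChange K).module_finite_point_holds
  obtain ⟨M₀, x₀, hx₀, hmax⟩ := exists_pow_smul_eq_and_forall_ne hnt (p := p) hp.two_le
  have hdiv : ∃ Q : (W.baseChange K).toAffine.Point, ((p ^ M₀ : ℕ) : ℤ) • Q = P :=
    ⟨x₀, by rw [natCast_zsmul]; exact hx₀⟩
  have hndiv : ¬ ∃ Q : (W.baseChange K).toAffine.Point, ((p ^ (M₀ + 1) : ℕ) : ℤ) • Q = P := by
    rintro ⟨Q, hQ⟩
    exact hmax Q (by rw [← natCast_zsmul]; exact hQ)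
  -- McCallum's Cor. 5.6, upper form, with `t := ord_p ∏c + s`
  have hle : padicValNat p (Nat.card (AddCommGroup.primaryComponent (W.baseChange K).sha p)) +
      2 * (padicValNat p W.tamagawaProduct + s) ≤ 2 * M₀ :=
    hMcU W hCM K hK h3 h4 hHH p hp2 hρ Dt H.β ι d₁ P hPd hnt M₀ hdiv hndiv
      (padicValNat p W.tamagawaProduct + s) (fun s' hs' n d hn hℓ ↦ hglob s' hs' n d hn hℓ)
  -- `ord_p #Ш ≤ ord_p #Ш[p^∞]` (no finiteness of `Ш` needed) and `ord_p [E(K):ℤP] = M₀`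
  have hsha := padicValNat_shaOrder_le_card_primaryComponent (W.baseChange K) p
  haveI : Finite (AddCommGroup.torsion (W.baseChange K).toAffine.Point) :=
    WeierstrassCurve.finite_torsion_point (W := W.baseChange K)
  obtain ⟨c, Q, hcQ, hcker⟩ := RankOne.exists_coord_of_mordellWeilRank_eq_one (W.baseChange K) hrank
  have hidx : padicValNat p (AddSubgroup.zmultiples P).index = M₀ :=
    Koly.padicValNat_index_zmultiples_eq_of_divisibility c Q hcQ hcker hiv P hdiv hndiv
  unfold Upper.IndexUpperBoundLeAt
  rw [hidx]
  omega

/-! ## §2 Ko BY NAME from J + the three primitives -/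

/-- **Crux Ko `WildKolyvaginUpperAtThree` ⟸ J (displayed, point currency, Ko's binders verbatim) + the THREE primitives
{`∀ K, casselsTate_levelInputs K`, `prop37_2_frobeniusCongruence`, `Gross1991_heegnerPoint_sub_ratTorsion_mem_E0`} — NO
`kolyvagin`.** McCallum's Cor. 5.6 (upper form) is bsd-stepL's kernel derivation from the three; §1 supplies the socket under
the crux's tower binder (`TowerSurjThree` → `ρ̄_{E,3^n}` onto for all `n`, as in w2's McCallum road); `d_K ≠ −4` from `d_K`
odd. CONDITIONAL on `hJ` (open research input) and the three named facts. [cite: McCallumLMS1991, §5 Cor. 5.6 (p. 310)]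
[cite: Jetchev2008, Conj. 1.3 and (1) (p. 812)] [cite: GrossLMS1991, §3 Prop. 3.7 (2), §6] [cite: MilneADT2006, Ch. I §6 Thm. 6.13(a)] -/
theorem wildKolyvaginUpperAtThree_of_globalDivisibility_of_threePrimitives
    (hCT : ∀ (K : Type) [Field K] [NumberField K], casselsTate_levelInputs K)
    (h372 : prop37_2_frobeniusCongruence) (hE0 : Gross1991_heegnerPoint_sub_ratTorsion_mem_E0)
    (hJ : ∀ (W : WeierstrassCurve ℚ) [W.IsElliptic] [W.IsGloballyMinimal] (N : ℕ) [NeZero N] (K : Type)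
      [Field K] [NumberField K] (Dt : ModularParametrizationData W N)
      (H : HeegnerDatum N (NumberField.discr K)) (ι : K →+* ℂ) (P : (W.baseChange K).toAffine.Point),
      ClassO6 W 3 → W.HasSurjectiveModNGaloisRep 3 → W.analyticRank = 1 → W.conductorNorm ℤ = N →
      IsImaginaryQuadratic K → SatisfiesHeegnerHypothesis N K →
      (W.quadraticTwist (NumberField.discr K : ℚ)).entireLFunction 1 ≠ 0 →
      WeierstrassCurve.Affine.Point.map ι.toRatAlgHom P = heegnerPointComplex Dt H →
      ¬ IsOfFinAddOrder P → Odd (NumberField.discr K) → NumberField.discr K ≠ -3 →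
      AdditiveThree.TowerSurjThree W →
      ∀ (s' : ℕ), s' ≤ padicValNat 3 W.tamagawaProduct + padicValNat 3 Dt.c.natAbs →
        ∀ (n : ℕ) (d : KolyvaginHeegnerData Dt H.β ι n), Squarefree n →
          (∀ ℓ ∈ n.primeFactors, Zhang2014.IsKolyvaginPrime N W K 3 ℓ ∧
            s' ≤ Zhang2014.kolyvaginIndex W 3 ℓ) → Koly.PDiv d 3 s') :
    WildKolyvaginUpperAtThree := by
  intro W _ _ N _ K _ _ Dt H ι P hO6 hsurj hr hN hK hHH hLd hP hnt hodd h3 htower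
  have hglob := hJ W N K Dt H ι P hO6 hsurj hr hN hK hHH hLd hP hnt hodd h3 htower
  subst hN
  haveI : Fact (Nat.Prime 3) := ⟨Nat.prime_three⟩
  have hD : NumberField.discr K < -4 :=
    WildKolyvaginUpperAtThreeOfMinftyGe.discr_lt_neg_four_of_odd hK hodd h3 H.dvd_sq_sub
  have h4 : NumberField.discr K ≠ -4 := by omega
  -- the tower in McCallum's spelling: `ρ̄_{E,3^n}` onto for every `n : ℕ` (level `3⁰` = trivial group)
  have hρ : ∀ n : ℕ, W.HasSurjectiveModNGaloisRep (3 ^ n : ℕ) := by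
    intro n
    cases n with
    | zero =>
      haveI : Subsingleton (geomTorsion W ((3 ^ 0 : ℕ) : ℤ)) := ⟨fun a b ↦ by
        have ha := AddSubgroup.torsionBy.nsmul_iff.mp a.2
        have hb := AddSubgroup.torsionBy.nsmul_iff.mp b.2
        simp only [pow_zero, one_smul] at ha hb
        exact Subtype.ext (ha.trans hb.symm)⟩
      intro y
      exact ⟨1, Multiplicative.toAdd.injective (AddEquiv.ext fun a ↦ Subsingleton.elim _ _)⟩
    | succ k => exact_mod_cast htower (k + 1) k.succ_pos
  exact upper_of_globalDivisibility_of_threePrimitives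
    (McCallum1991_padicValNat_card_sha_primary_add_le_of_globalDivisibility_of_casselsTate_of_frobeniusCongruence_of_E0
      hCT h372 hE0)
    h372 hE0 W 3 (by decide) hρ K hK h3 h4 hHH Dt H ι P hP hnt hglob

/-- **Ko BY NAME ⟸ J BY NAME (`WildSigmaDivisibilityAtThree`, stmt-20760, OPEN) + the three primitives** — line `birth` v3's
composition with its `kolyvagin` conjunct GONE. CONDITIONAL on J and the three named facts; Ko and J stay open.
[cite: McCallumLMS1991, §5 Cor. 5.6 (p. 310)] [cite: Jetchev2008, Conj. 1.3 (p. 812)] -/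
theorem wildKolyvaginUpperAtThree_of_sigma_of_threePrimitives (hJ : WildSigmaDivisibilityAtThree)
    (hCT : ∀ (K : Type) [Field K] [NumberField K], casselsTate_levelInputs K)
    (h372 : prop37_2_frobeniusCongruence) (hE0 : Gross1991_heegnerPoint_sub_ratTorsion_mem_E0) :
    WildKolyvaginUpperAtThree :=
  wildKolyvaginUpperAtThree_of_globalDivisibility_of_threePrimitives hCT h372 hE0
    fun W _ _ N _ K _ _ Dt H ι P hO6 hsurj hr hN hK hHH hLd hP hnt hodd h3 htower s' hs' n d hn hℓ ↦
      hJ W N K Dt H ι P hO6 hsurj hr hN hK hHH hLd hP hnt hodd h3 htower s' hs' n d hn hℓ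

end Summit.BirchSwinnertonDyer.BirchSwinnertonDyer.Theorems.WildKolyvaginUpperAtThreeOfThreePrimitives

end
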